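import Literature.Analysis.FunctionSpaces.Mollification
import Literature.Analysis.FluidPDE.HarmonicMeanValue
import Literature.Analysis.FluidPDE.PressurePoisson
import Literature.Analysis.FluidPDE.WeakGradientIBP
import HarnessLib

/-!
# The Helmholtz–Weyl annihilator lemma in `L^p(ℝⁿ)` and Liouville's theorem for `L^p` harmonic functions

Analysis/FluidPDE support file for the uniqueness theorem of Furioli–Lemarié-Rieusset–Terraneo
for mild Navier–Stokes solutions in `C([0,T); L³(ℝ³))` (`Literature.Analysis.FluidPDE.kato_unique`, ns.S13, via
`Literature/Analysis/FluidPDE/KatoUniqueness`): in the tree's duality (very weak) formulation of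
mild solutions the identity at time `0` only says that `u(0) - v(0)` pairs to zero with every
*divergence-free* test field, and one needs the following lemma to conclude `u(0) = v(0)` a.e.

Let `E` be a finite-dimensional real inner product space with its Lebesgue measure `volume`.

* `Literature.Analysis.FluidPDE.IsWeaklyDivFree.ae_eq_zero_of_memLp_of_forall_integral_inner_eq_zero`
  (**annihilator lemma**, PROVED): if `w ∈ L^p(E; E)`, `1 < p < ∞`, is weakly divergence free
  (accepted `Fluid.IsWeaklyDivFree`: `∫ ⟪w, ∇θ⟫ = 0` for `θ ∈ C_c^∞`) and `∫ ⟪w, φ⟫ = 0` for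
  every `φ ∈ C_c^∞(E; E)` with `div φ = 0` (accepted `Fluid.IsDivFree`, `IsTestFunctionOn ⊤`),
  then `w = 0` a.e. This is the uniqueness statement `L^p_σ ∩ G_p = {0}` behind the Helmholtz
  decomposition `L^p(ℝⁿ) = L^p_σ ⊕ G_p` (Hieber 2020, §1.10, Def. 1.10.1 and Prop. 1.10.4 (a);
  with the duality `P'_p = P_{p'}` an `L^p` field annihilated by the solenoidal tests lies in
  `G_p = ker P_p`).
* `InnerProductSpace.HarmonicOnNhd.eq_zero_of_memLp` (**Liouville in `L^p`**, PROVED): a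
  function harmonic on all of `E ≠ {0}` and in `L^p`, `1 < p < ∞`, vanishes identically.
* `Literature.Analysis.FluidPDE.laplacian_convolution_lsmul`, `Literature.Analysis.FluidPDE.fderiv_convolution_lsmul_apply`:
  derivatives of a mollification fall on the kernel, `Δ(φ ⋆ g) = (Δφ) ⋆ g` (Evans, *PDE*,
  App. C.4, Thm. 7).

## Proof (Lemarié-Rieusset 2016, proof of Thm. 4.4, pp. 56–57, run on mollifications)

Lemarié-Rieusset proves uniqueness in the Helmholtz decomposition by: a field which is both
solenoidal and irrotational is the gradient of a harmonic function, whose derivatives are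
harmonic and small at infinity, hence zero. Here "irrotational" is only known weakly (`w`
annihilates the solenoidal tests) and `w` is only `L^p`, so we argue on the components of the
mollifications `hₙ = φₙ ⋆ ⟪w, a⟫` (`a ∈ E`, `φₙ` the tree's mollifier sequence
`Literature.Analysis.FunctionSpaces.exists_contDiffBump_seq`):
1. (`integral_laplacian_mul_inner_eq_zero`) for every `θ ∈ C_c^∞(E)`, `∫ Δθ ⟪w, a⟫ = 0`:
   write `(Δθ) a = ∇(∂ₐθ) + ζ` with `ζ = (Δθ) a - ∇(∂ₐθ) ∈ C_c^∞(E; E)`; then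
   `div ζ = ∂ₐΔθ - Δ∂ₐθ = 0` (Schwarz), so `∫ ⟪w, ∇(∂ₐθ)⟫ = 0` by weak divergence-freeness and
   `∫ ⟪w, ζ⟫ = 0` by hypothesis — the weak form of `ΔF = ∇ div F - curl curl F`;
2. `hₙ` is smooth with `Δhₙ(x) = ((Δφₙ) ⋆ ⟪w, a⟫)(x) = ∫ Δ(φₙ(x - ·)) ⟪w, a⟫ = 0` by 1., so
   `hₙ` is harmonic on `E`, and `hₙ ∈ L^p` (Young, tree `Literature.Analysis.FunctionSpaces.memLp_normed_convolution`);
3. (`HarmonicOnNhd.eq_zero_of_memLp`) an `L^p` harmonic function vanishes: by the mean value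
   property in the weighted radial form of the tree (`Literature.Analysis.FluidPDE.integral_radial_mul_harmonic`,
   Gilbarg–Trudinger Thm. 2.1) with the cone weights `ρ_R(x) = max(1 - ‖x‖/R, 0)`,
   `Rⁿ (∫ρ₁) |h(x₀)| = |∫ ρ_R(x) h(x₀ + x) dx| ≤ ‖ρ_R‖_{p'} ‖h‖_p = O(R^{n/p'})` (Hölder), i.e.
   `|h(x₀)| = O(R^{-n/p}) → 0`;
4. `hₙ → ⟪w, a⟩` a.e. (Lebesgue differentiation, tree `Literature.Analysis.FunctionSpaces.ae_tendsto_normed_convolution`), so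
   `⟪w, a⟫ = 0` a.e. for each `a` of an orthonormal frame, whence `w = 0` a.e.

## Mathlib / tree search

Mathlib (this pin) has harmonic functions (`InnerProductSpace.HarmonicOnNhd`) with Liouville
only on `ℂ` (`Mathlib/Analysis/Complex/Harmonic/Liouville.lean`), no mean value property on
`ℝⁿ`, no Helmholtz decomposition or Leray projector on `L^p`, `p ≠ 2`; it has convolution with
`C^k` compactly supported kernels (`HasCompactSupport.hasFDerivAt_convolution_left`,
`contDiff_convolution_left`) and a.e. convergence of mollifiers. From the tree: the weighted mean
value property (`FluidPDE/HarmonicMeanValue`), Young's inequality and the mollifier sequence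
(`FunctionSpaces/Mollification`), `div ∇ = Δ` and the divergence algebra
(`FluidPDE/PressurePoisson`), `Δ = Σᵢ ∂ᵢ∂ᵢ` and Leibniz rules (`FluidPDE/WholeSpaceIBP`), local
integrability pairings (`FluidPDE/WeakGradientIBP`).

## References

* M. Hieber, *Analysis of viscous fluid flows: an approach by evolution equations*, in:
  Mathematical Analysis of the Navier–Stokes Equations, LNM 2254, Springer 2020, 1–146, §1.10
  (Def. 1.10.1, the duality remark `P'_p = P_{p'}`, Lemma 1.10.2, Prop. 1.10.4 (a)). Bib key
  `Hieber2020`.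
* P. G. Lemarié-Rieusset, *The Navier–Stokes problem in the 21st century*, CRC Press 2016,
  Thm. 4.4 and its proof (pp. 56–57), Def. 4.1 (Leray projection, `-ΔF = ∇∧(∇∧F₀)`),
  Lemma 6.3 (p. 104). Bib key `LemarieRieusset2016`.
* D. Gilbarg, N. S. Trudinger, *Elliptic partial differential equations of second order*
  (Springer, 2001 reprint), Thm. 2.1 (mean value). Bib key `GilbargTrudinger2001`.
* L. C. Evans, *Partial Differential Equations*, 2nd ed. (AMS 2010), App. C.4, Thm. 7
  (properties of mollifiers). Bib key `Evans2010`.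
-/

noncomputable section

open MeasureTheory TopologicalSpace Set Function Filter Topology InnerProductSpace
  ContinuousLinearMap Metric
open scoped RealInnerProductSpace ENNReal NNReal Convolution ContDiff Laplacian

namespace Literature.Analysis.FluidPDE

variable {E : Type*} [NormedAddCommGroup E] [InnerProductSpace ℝ E] [FiniteDimensional ℝ E]
  [MeasurableSpace E] [BorelSpace E]
variable {F : Type*} [NormedAddCommGroup F] [NormedSpace ℝ F]
variable {F' : Type*} [NormedAddCommGroup F'] [InnerProductSpace ℝ F']

/-! ### Derivatives of a mollification fall on the kernel -/

section ConvolutionCalculus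

/-- **Directional derivatives of a mollification.** For a `C¹` compactly supported kernel `φ`
and a locally integrable `g`, `∂_v (φ ⋆ g) = (∂_v φ) ⋆ g` pointwise (Evans, *PDE*, App. C.4,
Thm. 7 (i), proof; Mathlib's `HasCompactSupport.hasFDerivAt_convolution_left` evaluated at `v`). [folklore] -/
theorem fderiv_convolution_lsmul_apply {φ : E → ℝ} (hφ : ContDiff ℝ 1 φ)
    (hφc : HasCompactSupport φ) {g : E → F} (hg : LocallyIntegrable g volume) (x v : E) :
    fderiv ℝ (φ ⋆[lsmul ℝ ℝ, volume] g) x v =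
      ((fun t => fderiv ℝ φ t v) ⋆[lsmul ℝ ℝ, volume] g) x := by
  have hD := hφc.hasFDerivAt_convolution_left (lsmul ℝ ℝ) hφ hg x
  rw [hD.fderiv]
  have hint : ConvolutionExistsAt (fderiv ℝ φ) g x
      ((lsmul ℝ ℝ : ℝ →L[ℝ] F →L[ℝ] F).precompL E) volume :=
    (hφc.fderiv ℝ).convolutionExists_left _ (hφ.continuous_fderiv one_ne_zero) hg x
  rw [convolution_def, ContinuousLinearMap.integral_apply hint.integrable v, convolution_def]
  simp only [precompL_apply, lsmul_apply]

/-- **The Laplacian of a mollification falls on the kernel:** `Δ(φ ⋆ g) = (Δφ) ⋆ g` pointwise,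
for a `C²` compactly supported kernel `φ` and a locally integrable `g` (Evans, *PDE*, App. C.4,
Thm. 7 (i): `Dᵅ(η_ε ⋆ f) = (Dᵅη_ε) ⋆ f`). [folklore] -/
theorem laplacian_convolution_lsmul {φ : E → ℝ} (hφ : ContDiff ℝ 2 φ)
    (hφc : HasCompactSupport φ) {g : E → F'} (hg : LocallyIntegrable g volume) (x : E) :
    (Δ (φ ⋆[lsmul ℝ ℝ, volume] g)) x = ((Δ φ) ⋆[lsmul ℝ ℝ, volume] g) x := by
  set b := stdOrthonormalBasis ℝ E
  have hφ1 : ContDiff ℝ 1 φ := hφ.of_le one_le_two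
  have h2 : ContDiff ℝ 2 (φ ⋆[lsmul ℝ ℝ, volume] g) := hφc.contDiff_convolution_left _ hφ hg
  -- first and second directional derivatives of the kernel along the frame
  set φ' : Fin (Module.finrank ℝ E) → E → ℝ := fun i t => fderiv ℝ φ t (b i) with hφ'_def
  have hφ'1 : ∀ i, ContDiff ℝ 1 (φ' i) := fun i =>
    (hφ.fderiv_right (m := 1) le_rfl).clm_apply contDiff_const
  have hφ'c : ∀ i, HasCompactSupport (φ' i) := fun i => hφc.fderiv_apply (𝕜 := ℝ) (b i)
  set φ'' : Fin (Module.finrank ℝ E) → E → ℝ := fun i t => fderiv ℝ (φ' i) t (b i)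
    with hφ''_def
  have hφ''c : ∀ i, Continuous (φ'' i) := fun i =>
    ((hφ'1 i).continuous_fderiv one_ne_zero).clm_apply continuous_const
  have hφ''s : ∀ i, HasCompactSupport (φ'' i) := fun i =>
    (hφ'c i).fderiv_apply (𝕜 := ℝ) (b i)
  -- `∂ᵢ(φ ⋆ g) = φ'ᵢ ⋆ g` and `∂ᵢ∂ᵢ(φ ⋆ g) = φ''ᵢ ⋆ g`
  have hD1 : ∀ i, (fun y => fderiv ℝ (φ ⋆[lsmul ℝ ℝ, volume] g) y (b i)) =
      φ' i ⋆[lsmul ℝ ℝ, volume] g := fun i =>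
    funext fun y => fderiv_convolution_lsmul_apply hφ1 hφc hg y (b i)
  have hD2 : ∀ i, fderiv ℝ (fun y => fderiv ℝ (φ ⋆[lsmul ℝ ℝ, volume] g) y (b i)) x (b i) =
      (φ'' i ⋆[lsmul ℝ ℝ, volume] g) x := fun i => by
    rw [hD1 i]
    exact fderiv_convolution_lsmul_apply (hφ'1 i) (hφ'c i) hg x (b i)
  rw [laplacian_eq_sum_fderiv_fderiv b h2 x]
  simp_rw [hD2]
  have hΔφ : Δ φ = fun t => ∑ i, φ'' i t := funext fun t => laplacian_eq_sum_fderiv_fderiv b hφ t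
  rw [hΔφ]
  simp only [convolution_def, lsmul_apply]
  rw [← integral_finsetSum _ (fun i _ => ?_)]
  · refine integral_congr_ae (Eventually.of_forall fun t => ?_)
    simp only [Finset.sum_smul]
  · exact ((hφ''s i).convolutionExists_left (lsmul ℝ ℝ) (hφ''c i) hg x).integrable

omit [MeasurableSpace E] [BorelSpace E] in
/-- The Laplacian commutes with the reflection-translation `z ↦ a - z`:
`Δ(φ(a - ·))(x) = (Δφ)(a - x)` for `C²` functions. [folklore] -/
theorem laplacian_comp_sub_left {φ : E → ℝ} (hφ : ContDiff ℝ 2 φ) (a x : E) :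
    (Δ (fun z => φ (a - z))) x = (Δ φ) (a - x) := by
  set b := stdOrthonormalBasis ℝ E
  have hφ1 : ContDiff ℝ 1 φ := hφ.of_le one_le_two
  have hc : ContDiff ℝ 2 (fun z => φ (a - z)) := hφ.comp (contDiff_const.sub contDiff_id)
  rw [laplacian_eq_sum_fderiv_fderiv b hc x, laplacian_eq_sum_fderiv_fderiv b hφ (a - x)]
  refine Finset.sum_congr rfl fun i _ => ?_
  have h1 : (fun y => fderiv ℝ (fun z => φ (a - z)) y (b i)) =
      fun y => -fderiv ℝ φ (a - y) (b i) :=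
    funext fun y => FunctionSpaces.fderiv_comp_sub_left_apply hφ1 a y (b i)
  have hψ : ContDiff ℝ 1 (fun t => fderiv ℝ φ t (b i)) :=
    (hφ.fderiv_right (m := 1) le_rfl).clm_apply contDiff_const
  rw [h1, fderiv_fun_neg, _root_.neg_apply,
    FunctionSpaces.fderiv_comp_sub_left_apply (φ := fun t => fderiv ℝ φ t (b i)) hψ a x (b i), neg_neg]

omit [MeasurableSpace E] [BorelSpace E] [FiniteDimensional ℝ E] in
/-- Mixed second directional derivatives of a `C²` function commute (Schwarz):
`∂_u ∂_v f = ∂_v ∂_u f`. [folklore] -/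
theorem fderiv_fderiv_apply_comm {f : E → ℝ} (hf : ContDiff ℝ 2 f) (x u v : E) :
    fderiv ℝ (fun y => fderiv ℝ f y v) x u = fderiv ℝ (fun y => fderiv ℝ f y u) x v := by
  have hd : DifferentiableAt ℝ (fderiv ℝ f) x :=
    ((hf.fderiv_right (m := 1) le_rfl).differentiable one_ne_zero) x
  have h22 : minSmoothness ℝ 2 ≤ (2 : ℕ∞ω) := by
    rw [minSmoothness_of_isRCLikeNormedField]
  rw [fderiv_apply_const_apply hd, fderiv_apply_const_apply hd]
  exact (hf.contDiffAt.isSymmSndFDerivAt h22).eq u v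

omit [MeasurableSpace E] [BorelSpace E] in
/-- **`∂_a Δθ = Δ ∂_a θ`** for `θ ∈ C³` (Schwarz twice). [folklore] -/
theorem fderiv_laplacian_apply {θ : E → ℝ} (hθ : ContDiff ℝ 3 θ) (x a : E) :
    fderiv ℝ (Δ θ) x a = (Δ (fun y => fderiv ℝ θ y a)) x := by
  set b := stdOrthonormalBasis ℝ E
  have hθ2 : ContDiff ℝ 2 θ := hθ.of_le (by norm_num)
  have hDi : ∀ v : E, ContDiff ℝ 2 (fun y => fderiv ℝ θ y v) := fun v =>
    (hθ.fderiv_right (m := 2) le_rfl).clm_apply contDiff_const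
  have hDii : ∀ v : E, ContDiff ℝ 1 (fun y => fderiv ℝ (fun z => fderiv ℝ θ z v) y v) := fun v =>
    ((hDi v).fderiv_right (m := 1) le_rfl).clm_apply contDiff_const
  have hΔ : Δ θ = fun y => ∑ i, fderiv ℝ (fun z => fderiv ℝ θ z (b i)) y (b i) :=
    funext fun y => laplacian_eq_sum_fderiv_fderiv b hθ2 y
  rw [hΔ, fderiv_fun_sum fun i _ => ((hDii (b i)).differentiable one_ne_zero x),
    _root_.sum_apply, laplacian_eq_sum_fderiv_fderiv b (hDi a) x]
  refine Finset.sum_congr rfl fun i _ => ?_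
  -- `∂_a ∂_i ∂_i θ = ∂_i ∂_a ∂_i θ = ∂_i ∂_i ∂_a θ`
  rw [fderiv_fderiv_apply_comm (hDi (b i)) x a (b i)]
  have hin : (fun y => fderiv ℝ (fun z => fderiv ℝ θ z (b i)) y a) =
      fun y => fderiv ℝ (fun z => fderiv ℝ θ z a) y (b i) :=
    funext fun y => fderiv_fderiv_apply_comm hθ2 y a (b i)
  rw [hin]

end ConvolutionCalculus

/-! ### Solenoidal fields annihilating solenoidal tests are weakly harmonic -/

section WeakHarmonic

/-- **Componentwise weak harmonicity.** Let `w ∈ L¹_loc(E; E)` be weakly divergence free and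
annihilate every smooth compactly supported divergence-free field. Then every component of
`w` is weakly harmonic: `∫ Δθ · ⟪w, a⟫ = 0` for all `θ ∈ C_c^∞(E)` and `a ∈ E`. Indeed
`(Δθ) a = ∇(∂ₐθ) + ζ` with `ζ := (Δθ) a - ∇(∂ₐθ) ∈ C_c^∞` and `div ζ = ∂ₐΔθ - Δ∂ₐθ = 0`, so the
first pairing vanishes by `div w = 0` (weakly) and the second by hypothesis — the weak form of
`-ΔF = curl curl F - ∇ div F` (Lemarié-Rieusset 2016, proof of Thm. 4.4 and Def. 4.1, pp. 56–57:
a solenoidal irrotational field is the gradient of a harmonic function). [cite: LemarieRieusset2016, proof of Thm. 4.4 (uniqueness part) pp. 56–57] -/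
theorem integral_laplacian_mul_inner_eq_zero {w : E → E}
    (hwl : LocallyIntegrable w (volume : Measure E)) (hdiv : IsWeaklyDivFree w)
    (horth : ∀ φ : E → E, FunctionSpaces.IsTestFunctionOn (⊤ : Opens E) φ → VectorCalculus.IsDivFree φ →
      ∫ x, ⟪w x, φ x⟫ = 0)
    {θ : E → ℝ} (hθ : FunctionSpaces.IsTestFunctionOn (⊤ : Opens E) θ) (a : E) :
    ∫ x, (Δ θ) x * ⟪w x, a⟫ = 0 := by
  set b := stdOrthonormalBasis ℝ E
  have hθ2 : ContDiff ℝ 2 θ := contDiff_infty.1 hθ.contDiff 2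
  have hθ3 : ContDiff ℝ 3 θ := contDiff_infty.1 hθ.contDiff 3
  -- `g = ∂ₐθ` is a test function
  have hg : FunctionSpaces.IsTestFunctionOn (⊤ : Opens E) (fun y => fderiv ℝ θ y a) := hθ.fderiv_apply_const a
  have hg2 : ContDiff ℝ 2 (fun y => fderiv ℝ θ y a) := contDiff_infty.1 hg.contDiff 2
  -- `Δθ` is smooth with compact support
  have hΔ_eq : Δ θ = fun y => ∑ i, fderiv ℝ (fun z => fderiv ℝ θ z (b i)) y (b i) :=
    funext fun y => laplacian_eq_sum_fderiv_fderiv b hθ2 y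
  have hΔ_smooth : ContDiff ℝ (⊤ : ℕ∞) (Δ θ) := by
    rw [hΔ_eq]
    exact ContDiff.sum fun i _ =>
      ((hθ.fderiv_apply_const (b i)).fderiv_apply_const (b i)).contDiff
  have hΔ_supp : HasCompactSupport (Δ θ) :=
    HasCompactSupport.intro hθ.hasCompactSupport fun x hx =>
      laplacian_eq_zero_of_notMem_tsupport hx
  have hΔa_supp : HasCompactSupport (fun y => (Δ θ) y • a) :=
    HasCompactSupport.intro hΔ_supp fun x hx => by
      simp [image_eq_zero_of_notMem_tsupport hx]
  -- `∇g` is smooth with compact support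
  have hG_smooth : ContDiff ℝ (⊤ : ℕ∞) (gradient fun y => fderiv ℝ θ y a) := by
    refine contDiff_infty.2 fun n => ?_
    exact (InnerProductSpace.toDual ℝ E).symm.contDiff.comp
      (hg.contDiff.fderiv_right (m := n) (by exact_mod_cast le_top))
  have hG_supp : HasCompactSupport (gradient fun y => fderiv ℝ θ y a) :=
    (hg.hasCompactSupport.fderiv (𝕜 := ℝ)).comp_left
      (g := (InnerProductSpace.toDual ℝ E).symm) (map_zero _)
  -- the solenoidal test field `ζ = (Δθ) a - ∇g`
  set ζ : E → E := fun y => (Δ θ) y • a - gradient (fun y => fderiv ℝ θ y a) y with hζ_def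
  have hζ : FunctionSpaces.IsTestFunctionOn (⊤ : Opens E) ζ :=
    ⟨(hΔ_smooth.smul contDiff_const).sub hG_smooth, hΔa_supp.sub hG_supp, by simp⟩
  have hζdiv : VectorCalculus.IsDivFree ζ := by
    intro x
    have hΔd : DifferentiableAt ℝ (Δ θ) x := (hΔ_smooth.differentiable (by simp)) x
    have hd1 : DifferentiableAt ℝ (fun y => (Δ θ) y • a) x := hΔd.smul (differentiableAt_const a)
    have hd2 : DifferentiableAt ℝ (gradient fun y => fderiv ℝ θ y a) x :=
      (hG_smooth.differentiable (by simp)) x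
    have h1 : VectorCalculus.divergence (fun y => (Δ θ) y • a) x = fderiv ℝ (Δ θ) x a := by
      have h := divergence_smul_apply (θ := Δ θ) (u := fun _ : E => a) hΔd
        (differentiableAt_const a)
      have h0 : VectorCalculus.divergence (fun _ : E => a) x = 0 := by simp [VectorCalculus.divergence]
      rw [h0, mul_zero, zero_add, inner_gradient_eq_fderiv_apply] at h
      exact h
    rw [hζ_def, divergence_sub_apply hd1 hd2, divergence_gradient hg2, h1,
      fderiv_laplacian_apply hθ3, sub_self]
  -- the two vanishing pairings
  have e1 : ∫ x, ⟪w x, gradient (fun y => fderiv ℝ θ y a) x⟫ = 0 := hdiv _ hg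
  have e2 : ∫ x, ⟪w x, ζ x⟫ = 0 := horth ζ hζ hζdiv
  have i1 : Integrable (fun x => ⟪w x, (Δ θ) x • a⟫) volume :=
    integrable_inner_of_locallyIntegrable_of_hasCompactSupport hwl
      (hΔ_smooth.continuous.smul continuous_const) hΔa_supp
  have i2 : Integrable (fun x => ⟪w x, gradient (fun y => fderiv ℝ θ y a) x⟫) volume :=
    integrable_inner_of_locallyIntegrable_of_hasCompactSupport hwl hG_smooth.continuous hG_supp
  have hsplit : ∫ x, ⟪w x, ζ x⟫ =
      (∫ x, ⟪w x, (Δ θ) x • a⟫) - ∫ x, ⟪w x, gradient (fun y => fderiv ℝ θ y a) x⟫ := by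
    rw [← integral_sub i1 i2]
    refine integral_congr_ae (Eventually.of_forall fun x => ?_)
    simp only [hζ_def, inner_sub_right]
  rw [e2, e1, sub_zero] at hsplit
  calc ∫ x, (Δ θ) x * ⟪w x, a⟫ = ∫ x, ⟪w x, (Δ θ) x • a⟫ := by
        refine integral_congr_ae (Eventually.of_forall fun x => ?_)
        simp only [real_inner_smul_right]
    _ = 0 := hsplit.symm

end WeakHarmonic

/-! ### Liouville's theorem for `L^p` harmonic functions -/

section Liouville

/-- **Liouville's theorem in `L^p + L^q`.** On a finite-dimensional real inner product space
`E ≠ {0}`, a function `η` harmonic on all of `E` which splits as `η = η₁ + η₂` with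
`η₁ ∈ L^p`, `η₂ ∈ L^q` for some `1 < p, q < ∞` (no harmonicity asked of the pieces) vanishes
identically. Proof by the mean value property in the weighted radial form of the tree
(`Literature.Analysis.FluidPDE.integral_radial_mul_harmonic`, Gilbarg–Trudinger Thm. 2.1) with the cone weights
`ρ_R(x) = max(1 - ‖x‖/R, 0)`: `Rⁿ (∫ρ₁) |η(x₀)| = |∫ ρ_R(x) η(x₀ + x) dx| ≤ Σᵢ ‖ρ_R‖_{pᵢ'} ‖ηᵢ‖_{pᵢ}
= O(R^{n/p'}) + O(R^{n/q'})` by Hölder, so `|η(x₀)| = O(R^{-n/p} + R^{-n/q}) → 0`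
(Lemarié-Rieusset 2016, end of the proof of Thm. 4.4, p. 57: harmonic functions small at
infinity vanish; Gilbarg–Trudinger, Thm. 2.1). [cite: GilbargTrudinger2001, Thm 2.1] -/
theorem _root_.InnerProductSpace.HarmonicOnNhd.eq_zero_of_eq_add_memLp [Nontrivial E]
    {η η₁ η₂ : E → ℝ} (hη : HarmonicOnNhd η univ) (hsum : η = η₁ + η₂)
    {p q : ℝ≥0∞} (hp : 1 < p) (hp' : p < (⊤ : ℝ≥0∞)) (hq : 1 < q) (hq' : q < (⊤ : ℝ≥0∞))
    (h₁ : MemLp η₁ p (volume : Measure E)) (h₂ : MemLp η₂ q (volume : Measure E)) : η = 0 := by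
  -- the cone weight `ρ(x) = max(1 - ‖x‖, 0)`
  set ρ : E → ℝ := fun x => max (1 - ‖x‖) 0 with hρ_def
  have hρc : Continuous ρ := (continuous_const.sub continuous_norm).max continuous_const
  have hρ0 : ∀ x, 0 ≤ ρ x := fun x => le_max_right _ _
  have hρz : ∀ x : E, 1 ≤ ‖x‖ → ρ x = 0 := fun x hx => max_eq_right (by linarith)
  have hρs : HasCompactSupport ρ := by
    refine HasCompactSupport.intro (isCompact_closedBall (0 : E) 1) fun x hx => hρz x ?_
    rw [mem_closedBall_zero_iff, not_le] at hx
    exact hx.le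
  have hρrad : ∀ x y : E, ‖x‖ = ‖y‖ → ρ x = ρ y := fun x y h => by simp [hρ_def, h]
  have hρi : Integrable ρ volume := hρc.integrable_of_hasCompactSupport hρs
  have hI : 0 < ∫ x, ρ x := by
    rw [integral_pos_iff_support_of_nonneg hρ0 hρi]
    refine hρc.isOpen_support.measure_pos volume ⟨0, ?_⟩
    simp [hρ_def]
  set I := ∫ x, ρ x with hI_def
  set n := Module.finrank ℝ E with hn_def
  have hn : n ≠ 0 := Module.finrank_pos.ne'
  -- scaled weights
  set ρR : ℝ → E → ℝ := fun R x => ρ (R⁻¹ • x) with hρR_def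
  have hρRc : ∀ R, Continuous (ρR R) := fun R => hρc.comp (continuous_const.smul continuous_id)
  have hρRs : ∀ R, 0 < R → HasCompactSupport (ρR R) := fun R hR =>
    hρs.comp_smul (inv_ne_zero hR.ne')
  have hρRrad : ∀ R (x y : E), ‖x‖ = ‖y‖ → ρR R x = ρR R y := fun R x y h =>
    hρrad _ _ (by simp [norm_smul, h])
  have hρR0 : ∀ R x, 0 ≤ ρR R x := fun R x => hρ0 _
  have hmass : ∀ R, 0 < R → ∫ x, ρR R x = R ^ n * I := fun R hR => by
    have h := Measure.integral_comp_inv_smul_of_nonneg volume ρ hR.le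
    simpa [hρR_def, smul_eq_mul] using h
  -- Hölder bound for one `L^r` piece: `∫ ρ_R |g(x₀ + ·)| ≤ (Rⁿ)^{1/r'} K`
  have piece : ∀ {g : E → ℝ} {r : ℝ≥0∞}, 1 < r → r < (⊤ : ℝ≥0∞) → MemLp g r (volume : Measure E) →
      ∃ K : ℝ, 0 ≤ K ∧ ∀ (x₀ : E) (R : ℝ), 0 < R →
        ∫ x, ρR R x * ‖g (x₀ + x)‖ ≤ (R ^ n) ^ (1 / r.toReal.conjExponent) * K := by
    intro g r hr hr' hg
    have hrt : r ≠ ⊤ := hr'.ne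
    set s := r.toReal with hs_def
    have hs1 : 1 < s := by
      have h := (ENNReal.toReal_lt_toReal ENNReal.one_ne_top hrt).2 hr
      simpa using h
    have hsr : ENNReal.ofReal s = r := ENNReal.ofReal_toReal hrt
    have hst : s.HolderConjugate s.conjExponent := Real.HolderConjugate.conjExponent hs1
    set t := s.conjExponent with ht_def
    set Ct := ∫ x, ρ x ^ t with hCt_def
    have hCt0 : 0 ≤ Ct := integral_nonneg fun x => Real.rpow_nonneg (hρ0 x) t
    set M := ∫ x, ‖g x‖ ^ s with hM_def
    have hM0 : 0 ≤ M := integral_nonneg fun x => by positivity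
    refine ⟨Ct ^ (1 / t) * M ^ (1 / s), by positivity, fun x₀ R hR => ?_⟩
    have hmassq : ∫ x, ρR R x ^ t = R ^ n * Ct := by
      have h := Measure.integral_comp_inv_smul_of_nonneg volume (fun x => ρ x ^ t) hR.le
      simpa [hρR_def, smul_eq_mul] using h
    have hmem1 : MemLp (ρR R) (ENNReal.ofReal t) volume :=
      (hρRc R).memLp_of_hasCompactSupport (hρRs R hR)
    have hmem2 : MemLp (fun x => ‖g (x₀ + x)‖) (ENNReal.ofReal s) volume := by
      rw [hsr]
      exact (hg.comp_measurePreserving (measurePreserving_add_left volume x₀)).norm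
    have holder := integral_mul_le_Lp_mul_Lq_of_nonneg hst.symm (ae_of_all _ (hρR0 R))
      (ae_of_all _ fun x => norm_nonneg (g (x₀ + x))) hmem1 hmem2
    have htrans : ∫ x, ‖g (x₀ + x)‖ ^ s = M :=
      integral_add_left_eq_self (fun x => ‖g x‖ ^ s) x₀
    rw [hmassq, htrans, Real.mul_rpow (pow_pos hR n).le hCt0] at holder
    calc ∫ x, ρR R x * ‖g (x₀ + x)‖
        ≤ (R ^ n) ^ (1 / t) * Ct ^ (1 / t) * M ^ (1 / s) := holder
      _ = (R ^ n) ^ (1 / t) * (Ct ^ (1 / t) * M ^ (1 / s)) := by ring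
  obtain ⟨K₁, hK₁, hb₁⟩ := piece hp hp' h₁
  obtain ⟨K₂, hK₂, hb₂⟩ := piece hq hq' h₂
  -- exponents
  set a₁ := p.toReal.conjExponent with ha₁
  set a₂ := q.toReal.conjExponent with ha₂
  have hpa : p.toReal.HolderConjugate a₁ := Real.HolderConjugate.conjExponent (by
    have h := (ENNReal.toReal_lt_toReal ENNReal.one_ne_top hp'.ne).2 hp; simpa using h)
  have hqa : q.toReal.HolderConjugate a₂ := Real.HolderConjugate.conjExponent (by
    have h := (ENNReal.toReal_lt_toReal ENNReal.one_ne_top hq'.ne).2 hq; simpa using h)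
  have he₁ : 1 / a₁ - 1 = -(1 / p.toReal) := by
    have h := hpa.inv_add_inv_eq_one; simp only [one_div] at h ⊢; linarith
  have he₂ : 1 / a₂ - 1 = -(1 / q.toReal) := by
    have h := hqa.inv_add_inv_eq_one; simp only [one_div] at h ⊢; linarith
  -- the pointwise bound `I |η x₀| ≤ K₁ (Rⁿ)^{-1/p} + K₂ (Rⁿ)^{-1/q}`
  have key : ∀ (x₀ : E) (R : ℝ), 0 < R →
      I * |η x₀| ≤ K₁ * (R ^ n) ^ (-(1 / p.toReal)) + K₂ * (R ^ n) ^ (-(1 / q.toReal)) := by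
    intro x₀ R hR
    have hRn : (0 : ℝ) < R ^ n := pow_pos hR n
    have mvp := Literature.Analysis.FluidPDE.integral_radial_mul_harmonic hη (hρRc R) (hρRs R hR) (hρRrad R) x₀
    -- `|∫ ρ_R η(x₀ + ·)| ≤ ∫ ρ_R |η₁(x₀ + ·)| + ∫ ρ_R |η₂(x₀ + ·)|`
    have hi : ∀ {g : E → ℝ} {r : ℝ≥0∞}, 1 < r → MemLp g r (volume : Measure E) →
        Integrable (fun x => ρR R x * ‖g (x₀ + x)‖) volume := by
      intro g r hr hg
      have hgl : LocallyIntegrable (fun x => ‖g (x₀ + x)‖) volume :=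
        ((hg.comp_measurePreserving (measurePreserving_add_left volume x₀)).norm).locallyIntegrable
          hr.le
      have h := hgl.integrable_smul_left_of_hasCompactSupport (hρRc R) (hρRs R hR)
      simpa [smul_eq_mul] using h
    have habs : |∫ x, ρR R x * η (x₀ + x)| ≤
        (∫ x, ρR R x * ‖η₁ (x₀ + x)‖) + ∫ x, ρR R x * ‖η₂ (x₀ + x)‖ := by
      rw [← integral_add (hi hp h₁) (hi hq h₂)]
      refine abs_integral_le_integral_abs.trans (integral_mono_of_nonneg ?_ ?_ ?_)
      · exact Eventually.of_forall fun x => abs_nonneg _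
      · exact (hi hp h₁).add (hi hq h₂)
      · refine Eventually.of_forall fun x => ?_
        have hx : η (x₀ + x) = η₁ (x₀ + x) + η₂ (x₀ + x) := by rw [hsum]; rfl
        dsimp only
        rw [hx, abs_mul, abs_of_nonneg (hρR0 R x), ← mul_add, Real.norm_eq_abs,
          Real.norm_eq_abs]
        exact mul_le_mul_of_nonneg_left (abs_add_le _ _) (hρR0 R x)
    have hmain : R ^ n * (I * |η x₀|) ≤
        (R ^ n) ^ (1 / a₁) * K₁ + (R ^ n) ^ (1 / a₂) * K₂ := by
      have h : |(∫ x, ρR R x) * η x₀| = R ^ n * (I * |η x₀|) := by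
        rw [abs_mul, hmass R hR, abs_of_nonneg (by positivity), mul_assoc]
      rw [← h, ← mvp]
      exact habs.trans (add_le_add (hb₁ x₀ R hR) (hb₂ x₀ R hR))
    -- divide by `Rⁿ`
    have hdiv' : ∀ (a K : ℝ), (R ^ n) ^ (1 / a) * K / R ^ n = K * (R ^ n) ^ (1 / a - 1) :=
      fun a K => by rw [Real.rpow_sub_one hRn.ne']; ring
    have h2 := (le_div_iff₀' hRn).2 hmain
    rw [add_div, hdiv', hdiv', he₁, he₂] at h2
    exact h2
  -- let `R → ∞`
  have hlim : Tendsto (fun R : ℝ => K₁ * (R ^ n) ^ (-(1 / p.toReal)) +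
      K₂ * (R ^ n) ^ (-(1 / q.toReal))) atTop (𝓝 0) := by
    have hRn : Tendsto (fun R : ℝ => R ^ n) atTop atTop := tendsto_pow_atTop hn
    have t₁ := (tendsto_rpow_neg_atTop (by simpa using hpa.pos : 0 < 1 / p.toReal)).comp hRn
    have t₂ := (tendsto_rpow_neg_atTop (by simpa using hqa.pos : 0 < 1 / q.toReal)).comp hRn
    simpa using (t₁.const_mul K₁).add (t₂.const_mul K₂)
  funext x₀
  rw [Pi.zero_apply]
  have hle : I * |η x₀| ≤ 0 :=
    ge_of_tendsto hlim (Filter.eventually_atTop.2 ⟨1, fun R hR => key x₀ R (by linarith)⟩)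
  have habs0 : |η x₀| ≤ 0 := by
    by_contra h
    exact absurd hle (not_le.2 (mul_pos hI (not_le.1 h)))
  exact abs_nonpos_iff.1 habs0

/-- **Liouville's theorem in `L^p`.** On a finite-dimensional real inner product space `E ≠ {0}`,
a function harmonic on all of `E` which belongs to `L^p` for some `1 < p < ∞` vanishes
identically (the case `η₂ = 0` of `HarmonicOnNhd.eq_zero_of_eq_add_memLp`; consequence of the
mean value property, Gilbarg–Trudinger Thm. 2.1). [cite: GilbargTrudinger2001, Thm 2.1] -/
theorem _root_.InnerProductSpace.HarmonicOnNhd.eq_zero_of_memLp [Nontrivial E] {η : E → ℝ}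
    (hη : HarmonicOnNhd η univ) {p : ℝ≥0∞} (hp : 1 < p) (hp' : p < (⊤ : ℝ≥0∞))
    (hηp : MemLp η p (volume : Measure E)) : η = 0 :=
  hη.eq_zero_of_eq_add_memLp (η₁ := η) (η₂ := 0) (by simp) hp hp' ENNReal.one_lt_two
    ENNReal.ofNat_lt_top hηp MemLp.zero

end Liouville

/-! ### The annihilator lemma -/

section Annihilator

/-- **Annihilator lemma in `L^p + L^q` (uniqueness in the Helmholtz–Weyl decomposition),
PROVED.** Let `E` be a finite-dimensional real inner product space with its Lebesgue measure,
`1 < p, q < ∞`, and `w = w₁ + w₂` with `w₁ ∈ L^p(E; E)`, `w₂ ∈ L^q(E; E)`. If `w` is weakly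
divergence free (`∫ ⟪w, ∇θ⟫ = 0` for `θ ∈ C_c^∞`) and `∫ ⟪w, φ⟫ = 0` for every
`φ ∈ C_c^∞(E; E)` with `div φ = 0`, then `w = 0` a.e. (The `L^p` statement is the uniqueness
`L^p_σ ∩ G_p = {0}` behind the Helmholtz decomposition `L^p(ℝⁿ) = L^p_σ ⊕ G_p`, Hieber 2020,
§1.10, Def. 1.10.1 and Prop. 1.10.4 (a), with the duality `P'_p = P_{p'}`; the sum version is
what very weak Navier–Stokes solutions in `L³` produce, the Duhamel term lying in `L²`.)
Proof (Lemarié-Rieusset 2016, proof of Thm. 4.4, pp. 56–57, "solenoidal and irrotational ⇒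
gradient of a harmonic function ⇒ 0", run on mollifications): for `a ∈ E` and a mollifier
`φₖ`, the component `hₖ = φₖ ⋆ ⟪w, a⟫` is smooth with `Δhₖ(x) = ∫ Δ(φₖ(x - ·)) ⟪w, a⟫ = 0`
(`laplacian_convolution_lsmul`, `integral_laplacian_mul_inner_eq_zero`), and splits as
`φₖ ⋆ ⟪w₁, a⟫ + φₖ ⋆ ⟪w₂, a⟫ ∈ L^p + L^q` (Young), so `hₖ = 0` by Liouville
(`HarmonicOnNhd.eq_zero_of_eq_add_memLp`); as `hₖ → ⟪w, a⟫` a.e. (Lebesgue differentiation),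
`⟪w, a⟫ = 0` a.e. for every `a` of an orthonormal frame. [cite: Hieber2020, §1.10, Def. 1.10.1 and Prop. 1.10.4 (a)] -/
theorem IsWeaklyDivFree.ae_eq_zero_of_add_memLp_of_forall_integral_inner_eq_zero {p q : ℝ≥0∞}
    (hp : 1 < p) (hp' : p < (⊤ : ℝ≥0∞)) (hq : 1 < q) (hq' : q < (⊤ : ℝ≥0∞)) {w₁ w₂ : E → E}
    (hw₁ : MemLp w₁ p (volume : Measure E)) (hw₂ : MemLp w₂ q (volume : Measure E))
    (hdiv : IsWeaklyDivFree (w₁ + w₂))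
    (horth : ∀ φ : E → E, FunctionSpaces.IsTestFunctionOn (⊤ : Opens E) φ → VectorCalculus.IsDivFree φ →
      ∫ x, ⟪(w₁ + w₂) x, φ x⟫ = 0) :
    w₁ + w₂ =ᵐ[volume] 0 := by
  rcases subsingleton_or_nontrivial E with hE | hE
  · exact Eventually.of_forall fun x => Subsingleton.elim _ _
  have hp1 : 1 ≤ p := hp.le
  have hq1 : 1 ≤ q := hq.le
  set b := stdOrthonormalBasis ℝ E
  set w : E → E := w₁ + w₂ with hw_def
  have hwl : LocallyIntegrable w volume :=
    (hw₁.locallyIntegrable hp1).add (hw₂.locallyIntegrable hq1)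
  -- every component `⟪w, a⟫` vanishes a.e.
  have hcomp : ∀ a : E, ∀ᵐ y ∂(volume : Measure E), ⟪w y, a⟫ = 0 := by
    intro a
    set wa : E → ℝ := fun y => ⟪w y, a⟫ with hwa_def
    set wa₁ : E → ℝ := fun y => ⟪w₁ y, a⟫ with hwa₁_def
    set wa₂ : E → ℝ := fun y => ⟪w₂ y, a⟫ with hwa₂_def
    have hwa₁ : MemLp wa₁ p volume := hw₁.inner_const a
    have hwa₂ : MemLp wa₂ q volume := hw₂.inner_const a
    have hwa₁l : LocallyIntegrable wa₁ volume := hwa₁.locallyIntegrable hp1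
    have hwa₂l : LocallyIntegrable wa₂ volume := hwa₂.locallyIntegrable hq1
    have hwa_eq : wa = wa₁ + wa₂ := by
      funext y
      simp only [hwa_def, hwa₁_def, hwa₂_def, hw_def, Pi.add_apply, inner_add_left]
    have hwal : LocallyIntegrable wa volume := by rw [hwa_eq]; exact hwa₁l.add hwa₂l
    obtain ⟨φ, hφ0, hφ2⟩ := FunctionSpaces.exists_contDiffBump_seq (E := E)
    -- each mollification `φₖ ⋆ wa` is a harmonic function in `L^p + L^q`, hence zero
    have hzero : ∀ (k : ℕ) (x : E), ((φ k).normed volume ⋆[lsmul ℝ ℝ, volume] wa) x = 0 := by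
      intro k
      set ψ : E → ℝ := (φ k).normed volume with hψ_def
      have hψ : FunctionSpaces.IsTestFunctionOn (⊤ : Opens E) ψ := FunctionSpaces.isTestFunctionOn_normed (φ k)
      have hψ2 : ContDiff ℝ 2 ψ := contDiff_infty.1 hψ.contDiff 2
      have hh2 : ContDiff ℝ 2 (ψ ⋆[lsmul ℝ ℝ, volume] wa) :=
        hψ.hasCompactSupport.contDiff_convolution_left _ hψ2 hwal
      have hΔ : ∀ x, Δ (ψ ⋆[lsmul ℝ ℝ, volume] wa) x = 0 := by
        intro x
        rw [laplacian_convolution_lsmul hψ2 hψ.hasCompactSupport hwal x, convolution_def]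
        simp only [lsmul_apply, smul_eq_mul]
        have e := integral_sub_left_eq_self (fun t => (Δ ψ) t * wa (x - t)) volume x
        simp only [sub_sub_cancel] at e
        rw [← e]
        have hθ : FunctionSpaces.IsTestFunctionOn (⊤ : Opens E) (fun z => ψ (x - z)) := hψ.comp_sub_left x
        have key := integral_laplacian_mul_inner_eq_zero hwl hdiv horth hθ a
        simp_rw [laplacian_comp_sub_left hψ2 x] at key
        exact key
      have hharm : HarmonicOnNhd (ψ ⋆[lsmul ℝ ℝ, volume] wa) univ := fun x _ =>
        ⟨hh2.contDiffAt, Eventually.of_forall fun y => hΔ y⟩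
      -- the splitting `φₖ ⋆ wa = φₖ ⋆ wa₁ + φₖ ⋆ wa₂ ∈ L^p + L^q`
      have hsplit : ψ ⋆[lsmul ℝ ℝ, volume] wa =
          ψ ⋆[lsmul ℝ ℝ, volume] wa₁ + ψ ⋆[lsmul ℝ ℝ, volume] wa₂ := by
        funext x
        rw [hwa_eq, Pi.add_apply]
        exact (hψ.hasCompactSupport.convolutionExists_left _ hψ.contDiff.continuous hwa₁l x)
          |>.distrib_add
          (hψ.hasCompactSupport.convolutionExists_left _ hψ.contDiff.continuous hwa₂l x)
      have hm₁ : MemLp (ψ ⋆[lsmul ℝ ℝ, volume] wa₁) p volume :=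
        FunctionSpaces.memLp_normed_convolution (φ k) hwa₁ hp1
      have hm₂ : MemLp (ψ ⋆[lsmul ℝ ℝ, volume] wa₂) q volume :=
        FunctionSpaces.memLp_normed_convolution (φ k) hwa₂ hq1
      have h0 := hharm.eq_zero_of_eq_add_memLp hsplit hp hp' hq hq' hm₁ hm₂
      exact fun x => congrFun h0 x
    have hlim := FunctionSpaces.ae_tendsto_normed_convolution hφ0 hφ2 hwal
    filter_upwards [hlim] with x hx
    simp_rw [hzero] at hx
    exact tendsto_nhds_unique hx tendsto_const_nhds
  -- assemble along an orthonormal frame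
  have hall : ∀ᵐ y ∂(volume : Measure E), ∀ i, ⟪w y, b i⟫ = 0 :=
    ae_all_iff.2 fun i => hcomp (b i)
  filter_upwards [hall] with y hy
  rw [Pi.zero_apply, ← b.sum_repr' (w y)]
  exact Finset.sum_eq_zero fun i _ => by rw [real_inner_comm, hy i, zero_smul]

/-- **Annihilator lemma in `L^p` (uniqueness in the Helmholtz–Weyl decomposition of `L^p(ℝⁿ)`),
PROVED.** Let `E` be a finite-dimensional real inner product space with its Lebesgue measure
and `1 < p < ∞`. If `w ∈ L^p(E; E)` is weakly divergence free (`∫ ⟪w, ∇θ⟫ = 0` for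
`θ ∈ C_c^∞`) and `∫ ⟪w, φ⟫ = 0` for every `φ ∈ C_c^∞(E; E)` with `div φ = 0`, then `w = 0`
a.e. In the language of Hieber 2020, §1.10 (Def. 1.10.1 with the duality remark
`P'_p = P_{p'}` and Prop. 1.10.4 (a), `Ω = ℝⁿ`): `w` is annihilated by `L^{p'}_σ`, hence lies
in `G_p = ker P_p`, and `div w = 0` forces `w = 0` since `L^p = L^p_σ ⊕ G_p`. The case
`w₂ = 0` of `IsWeaklyDivFree.ae_eq_zero_of_add_memLp_of_forall_integral_inner_eq_zero`. [cite: Hieber2020, §1.10, Def. 1.10.1 and Prop. 1.10.4 (a)] -/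
theorem IsWeaklyDivFree.ae_eq_zero_of_memLp_of_forall_integral_inner_eq_zero {p : ℝ≥0∞}
    (hp : 1 < p) (hp' : p < (⊤ : ℝ≥0∞)) {w : E → E} (hw : MemLp w p (volume : Measure E))
    (hdiv : IsWeaklyDivFree w)
    (horth : ∀ φ : E → E, FunctionSpaces.IsTestFunctionOn (⊤ : Opens E) φ → VectorCalculus.IsDivFree φ →
      ∫ x, ⟪w x, φ x⟫ = 0) :
    w =ᵐ[volume] 0 := by
  have h := IsWeaklyDivFree.ae_eq_zero_of_add_memLp_of_forall_integral_inner_eq_zero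
    (w₁ := w) (w₂ := 0) hp hp' ENNReal.one_lt_two ENNReal.ofNat_lt_top hw MemLp.zero
    (by simpa using hdiv) (by simpa using horth)
  simpa using h

end Annihilator

end Literature.Analysis.FluidPDE
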